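import Literature.RingTheory.Idempotents.PrimitiveDecomposition
import Mathlib.RingTheory.LocalProperties.IntegrallyClosed
import Mathlib.RingTheory.LocalProperties.Reduced
import Mathlib.RingTheory.Localization.LocalizationLocalization
import Mathlib.RingTheory.Ideal.MinimalPrime.Noetherian
import Mathlib.RingTheory.Ideal.Quotient.Noetherian
import HarnessLib

/-!
# Primitive idempotents of a noetherian ring; blocks of a reduced noetherian ring that is locally a domain

`Literature/RingTheory/Idempotents/PrimitiveIdempotentsOfReducedNoetherian.lean`, namespace
`Literature.RingTheory.Idempotents` (sequel of `PrimitiveDecomposition.lean`, whose EXISTENCE theorem is the left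
ARTINIAN case).  THEOREMS only (no definition, no instance, no notation, no named fact, no `sorry`).

* §1 **Existence of primitive decompositions in a left NOETHERIAN ring** (`IsPrimitiveDecomposition.exists_of_isNoetherianRing`):
  every idempotent `e` is a finite sum of pairwise orthogonal primitive idempotents — the artinian proof of
  `PrimitiveDecomposition.lean` run on the COMPLEMENTARY left ideals `R(1 - e)`, which INCREASE under a splitting
  `e = α + β` (`1 - e = (1 - β)(1 - α)`, `β = β(1 - α) ∉ R(1 - e)`), so that noetherian induction applies.  Hence `1` is a
  sum of orthogonal primitive idempotents and (commutative case) the primitive idempotents are finitely many and form a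
  complete orthogonal family by themselves (§2).
* §3 **The block `A ⧸ (1 - f)` at a primitive idempotent `f` of a commutative ring has no non-trivial idempotents.**
* §4 **A reduced noetherian commutative ring without non-trivial idempotents whose localisations at maximal ideals are
  domains is a domain** (its minimal primes are pairwise comaximal, and two of them would produce a non-trivial idempotent).
* §5 **Blocks of a reduced noetherian ring that is locally an (integrally closed) domain are (integrally closed) domains**
  (`isDomain_quotient_span_one_sub_of_isPrimitiveIdempotent`, `isIntegrallyClosed_quotient_span_one_sub_of_isPrimitiveIdempotent`):
  `A ⧸ (1 - f)` is the localisation `A_f`, so it is reduced and its local rings are local rings of `A`.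
  This is the «fibre-chart» input of the invariants-of-permuted-blocks computation (a finite group permuting the
  connected components of a smooth, possibly disconnected, affine curve): cell `hodgecm-mathlib`, FLOOR 0, P5a, MOD-PLAN
  row L6.6 (N2), crux item stmt-HodgeConjecture-24832 — generic commutative algebra, changes no count.

Sources: T. Y. Lam, *A First Course in Noncommutative Rings* (2nd ed.), §21 Prop. (21.8), §22 Prop. (22.1) and Thm.
(22.5)–(22.6) (block decompositions; the noetherian variant of the existence argument of `PrimitiveDecomposition.lean`);
[Stacks Project, Tag 00EC (Lemma 10.21.1: idempotents vs. clopen subsets of `Spec`) and Tag 030C (Lemma 10.37.16: a reduced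
ring with finitely many minimal primes is normal iff it is a finite product of normal domains), Definition 00GV (normal ring)];
Mathlib `IsIntegrallyClosed.of_localization_maximal`, `IsLocalization.away_of_isIdempotentElem`.
HC_CM is proved only modulo the 7 printed citations until rung 0 closes.
-/

set_option autoImplicit false

namespace Literature.RingTheory.Idempotents

/-! ### §1 Existence of primitive decompositions in a left noetherian ring -/

section Noetherian

variable {R : Type*} [Ring R]

/-- For idempotents `α`, `β` with `β α = 0`: `1 - (α + β) = (1 - β) * (1 - α)`, so `R(1 - (α + β)) ≤ R(1 - α)`. [folklore] -/
private theorem one_sub_add_eq_mul {α β : R} (hβα : β * α = 0) : 1 - (α + β) = (1 - β) * (1 - α) := by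
  rw [sub_mul, one_mul, mul_sub, mul_one, hβα, sub_zero]; abel

/-- For an orthogonal splitting `e = α + β` into idempotents with `β ≠ 0`, the complementary left ideal grows strictly:
`R(1 - (α + β)) < R(1 - α)` (`β = β(1 - α)` lies in the larger one, and `β ∈ R(1 - e)` would force `β = β·β = c(1 - e)β = 0`
as `eβ = β`). [cite: Lam2001FirstCourse, §21 (21.1)–(21.3) and Prop. (21.8)] -/
theorem span_singleton_one_sub_add_lt {α β : R} (hβ : IsIdempotentElem β) (hβ0 : β ≠ 0)
    (hαβ : α * β = 0) (hβα : β * α = 0) :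
    Ideal.span ({1 - (α + β)} : Set R) < Ideal.span ({1 - α} : Set R) := by
  refine lt_of_le_of_ne ((Ideal.span_singleton_le_iff_mem _).2
    (Ideal.mem_span_singleton'.2 ⟨1 - β, (one_sub_add_eq_mul hβα).symm⟩)) fun h ↦ ?_
  have hmem : β ∈ Ideal.span ({1 - α} : Set R) :=
    Ideal.mem_span_singleton'.2 ⟨β, by rw [mul_sub, mul_one, hβα, sub_zero]⟩
  rw [← h] at hmem
  obtain ⟨c, hc⟩ := Ideal.mem_span_singleton'.1 hmem
  apply hβ0
  have heβ : (α + β) * β = β := by rw [add_mul, hαβ, hβ.eq, zero_add]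
  calc β = β * β := hβ.eq.symm
    _ = c * ((1 - (α + β)) * β) := by rw [← mul_assoc, hc]
    _ = 0 := by rw [sub_mul, one_mul, heβ, sub_self, mul_zero]

/-- **EXISTENCE OF PRIMITIVE DECOMPOSITIONS IN A LEFT NOETHERIAN RING: every idempotent `e` is a finite sum of pairwise
orthogonal primitive idempotents.**  Noetherian induction on the complementary left ideal `R(1 - e)`: a non-zero non-primitive
`e` splits as `α + β` with `α, β ≠ 0` orthogonal idempotents ((21.8)(3)), `R(1 - e) < R(1 - α), R(1 - β)`, and decompositions of
`α` and `β` glue (★ `IsPrimitiveDecomposition.union`). [cite: Lam2001FirstCourse, §22 Thm. (22.6) (proof) and §21 Prop. (21.8)] -/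
theorem IsPrimitiveDecomposition.exists_of_isNoetherianRing [IsNoetherianRing R] {e : R} (he : IsIdempotentElem e) :
    ∃ S : Finset R, IsPrimitiveDecomposition S e := by
  classical
  suffices H : ∀ I : Ideal R, ∀ e : R, IsIdempotentElem e → Ideal.span ({1 - e} : Set R) = I →
      ∃ S : Finset R, IsPrimitiveDecomposition S e from H _ e he rfl
  intro I
  induction I using IsNoetherian.induction with
  | hgt I ih =>
    intro e he hI
    subst hI
    by_cases h0 : e = 0
    · exact ⟨∅, by rw [h0]; exact IsPrimitiveDecomposition.empty⟩
    by_cases hp : IsPrimitiveIdempotent e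
    · exact ⟨{e}, IsPrimitiveDecomposition.singleton hp⟩
    obtain ⟨α, β, hα, hβ, hα0, hβ0, hαβ, hβα, rfl⟩ : ∃ α β : R, IsIdempotentElem α ∧ IsIdempotentElem β ∧ α ≠ 0 ∧ β ≠ 0 ∧
        α * β = 0 ∧ β * α = 0 ∧ α + β = e := by
      by_contra hcon
      exact hp (Corner.isPrimitiveIdempotent_iff_not_exists_orthogonal.2 ⟨he, h0, hcon⟩)
    obtain ⟨A, hA⟩ := ih _ (span_singleton_one_sub_add_lt hβ hβ0 hαβ hβα) α hα rfl
    obtain ⟨B, hB⟩ := ih _ (by rw [add_comm]; exact span_singleton_one_sub_add_lt hα hα0 hβα hαβ) β hβ rfl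
    exact ⟨A ∪ B, (hA.union hB hαβ hβα).2⟩

/-- **`1` is a sum of pairwise orthogonal primitive idempotents in a left noetherian ring.**
[cite: Lam2001FirstCourse, §22 Thm. (22.5)–(22.6)] -/
theorem IsPrimitiveDecomposition.exists_one_of_isNoetherianRing [IsNoetherianRing R] :
    ∃ S : Finset R, IsPrimitiveDecomposition S (1 : R) :=
  IsPrimitiveDecomposition.exists_of_isNoetherianRing IsIdempotentElem.one

/-- In the indexed form: **a left noetherian ring has a complete finite family of orthogonal PRIMITIVE idempotents.**
[cite: Lam2001FirstCourse, §22 Thm. (22.5)–(22.6)] -/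
theorem exists_completeOrthogonalIdempotents_isPrimitiveIdempotent_of_isNoetherianRing [IsNoetherianRing R] :
    ∃ S : Finset R, CompleteOrthogonalIdempotents (Subtype.val : S → R) ∧ ∀ x : S, IsPrimitiveIdempotent (x : R) := by
  obtain ⟨S, hS⟩ := IsPrimitiveDecomposition.exists_one_of_isNoetherianRing (R := R)
  exact ⟨S, hS.completeOrthogonalIdempotents, fun x ↦ hS.prim x.1 x.2⟩

end Noetherian

/-! ### §2 Commutative rings: the primitive idempotents are finitely many and form a complete orthogonal family -/

section Commutative

variable {A : Type*} [CommRing A]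

/-- In a commutative ring, a complete orthogonal family of primitive idempotents contains every primitive idempotent
(`f = Σ f·x`, each `f·x ∈ {0, f}` by primitivity of `f`, and `f·x = f ≠ 0` forces `f = x` by primitivity of `x`).
[cite: Lam2001FirstCourse, §22 Prop. (22.1) and Thm. (22.5)] -/
private theorem mem_of_isPrimitiveIdempotent {S : Finset A} (hS : IsPrimitiveDecomposition S (1 : A)) {f : A}
    (hf : IsPrimitiveIdempotent f) : f ∈ S := by
  have hcases : ∀ x ∈ S, f * x = 0 ∨ f * x = f := fun x hx =>
    hf.eq_zero_or_eq (f * x) (hf.isIdempotentElem.mul_of_commute (Commute.all f x) (hS.idem hx))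
      (by rw [mul_right_comm, hf.isIdempotentElem.eq]) (by rw [← mul_assoc, hf.isIdempotentElem.eq])
  -- not all `f x` vanish since `Σ_{x ∈ S} f x = f ≠ 0`
  obtain ⟨x, hx, hfx⟩ : ∃ x ∈ S, f * x = f := by
    by_contra h
    have h0 : ∀ x ∈ S, f * x = 0 := fun x hx => (hcases x hx).resolve_right fun hfx => h ⟨x, hx, hfx⟩
    apply hf.ne_zero
    calc f = f * ∑ x ∈ S, x := by rw [hS.sum_eq, mul_one]
      _ = ∑ x ∈ S, f * x := Finset.mul_sum _ _ _
      _ = 0 := Finset.sum_eq_zero h0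
  -- `f ≤ x` and `x` primitive ⇒ `f = x`
  rcases (hS.prim x hx).eq_zero_or_eq f hf.isIdempotentElem hfx (by rw [mul_comm, hfx]) with h0 | hfx'
  · exact absurd h0 hf.ne_zero
  · rwa [hfx']

/-- **A commutative noetherian ring has only finitely many primitive idempotents** (they all belong to any primitive
decomposition of `1`). [cite: Lam2001FirstCourse, §22 Thm. (22.5)–(22.6)] -/
theorem finite_setOf_isPrimitiveIdempotent [IsNoetherianRing A] : Set.Finite {f : A | IsPrimitiveIdempotent f} := by
  obtain ⟨S, hS⟩ := IsPrimitiveDecomposition.exists_one_of_isNoetherianRing (R := A)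
  exact (S.finite_toSet).subset fun f hf => mem_of_isPrimitiveIdempotent hS hf

/-- Two DISTINCT primitive idempotents of a commutative ring are orthogonal (`f f'` is a sub-idempotent of both).
[cite: Lam2001FirstCourse, §22 Prop. (22.1)] -/
theorem mul_eq_zero_of_isPrimitiveIdempotent_of_ne {f f' : A} (hf : IsPrimitiveIdempotent f)
    (hf' : IsPrimitiveIdempotent f') (hne : f ≠ f') : f * f' = 0 := by
  have hidem : IsIdempotentElem (f * f') := hf.isIdempotentElem.mul_of_commute (Commute.all f f') hf'.isIdempotentElem
  rcases hf.eq_zero_or_eq (f * f') hidem (by rw [mul_right_comm, hf.isIdempotentElem.eq])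
    (by rw [← mul_assoc, hf.isIdempotentElem.eq]) with h0 | h1
  · exact h0
  rcases hf'.eq_zero_or_eq (f * f') hidem (by rw [mul_assoc, hf'.isIdempotentElem.eq])
    (by rw [mul_comm f' (f * f'), mul_assoc, hf'.isIdempotentElem.eq]) with h0 | h2
  · exact h0
  · exact absurd (h1.symm.trans h2) hne

/-- **In a commutative noetherian ring the primitive idempotents THEMSELVES form a complete orthogonal family** (indexed
by the finite type `{f // IsPrimitiveIdempotent f}`, for any `Fintype` structure on it — one exists by
`finite_setOf_isPrimitiveIdempotent`). [cite: Lam2001FirstCourse, §22 Thm. (22.5)–(22.6)] -/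
theorem completeOrthogonalIdempotents_subtype_isPrimitiveIdempotent [IsNoetherianRing A]
    [Fintype {f : A // IsPrimitiveIdempotent f}] :
    CompleteOrthogonalIdempotents (Subtype.val : {f : A // IsPrimitiveIdempotent f} → A) := by
  classical
  obtain ⟨S, hS⟩ := IsPrimitiveDecomposition.exists_one_of_isNoetherianRing (R := A)
  refine ⟨⟨fun f => f.2.isIdempotentElem, fun f f' hne =>
    mul_eq_zero_of_isPrimitiveIdempotent_of_ne f.2 f'.2 fun h => hne (Subtype.ext h)⟩, ?_⟩
  -- the sum over all primitive idempotents is the sum over `S`, which is `1`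
  have hι : Function.Bijective (fun x : S => (⟨x.1, hS.prim x.1 x.2⟩ : {f : A // IsPrimitiveIdempotent f})) := by
    refine ⟨fun x y h => Subtype.ext ?_, fun f => ⟨⟨f.1, mem_of_isPrimitiveIdempotent hS f.2⟩, rfl⟩⟩
    have h' := congrArg (fun z : {f : A // IsPrimitiveIdempotent f} => z.1) h
    exact h'
  rw [← (Equiv.ofBijective _ hι).sum_comp]
  change ∑ x : S, (x : A) = 1
  rw [Finset.sum_coe_sort S (fun x : A => x), hS.sum_eq]

/-! ### §3 The block at a primitive idempotent has no non-trivial idempotents -/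

/-- In the block `A ⧸ (1 - f)` the class of `f` is `1`. [folklore] -/
private theorem mk_span_one_sub_self' (f : A) : Ideal.Quotient.mk (Ideal.span {1 - f}) f = 1 := by
  rw [eq_comm, ← map_one (Ideal.Quotient.mk (Ideal.span {1 - f})), Ideal.Quotient.eq]
  exact Ideal.subset_span rfl

/-- **The block `A ⧸ (1 - f)` at a PRIMITIVE idempotent `f` of a commutative ring has no non-trivial idempotents**: an
idempotent `x̄` lifts to the sub-idempotent `f·x` of `f`, which is `0` or `f`. [cite: Lam2001FirstCourse, §21 Prop. (21.8) (2)] -/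
theorem eq_zero_or_eq_one_of_isIdempotentElem_quotient {f : A} (hf : IsPrimitiveIdempotent f)
    (x : A ⧸ Ideal.span {1 - f}) (hx : IsIdempotentElem x) : x = 0 ∨ x = 1 := by
  obtain ⟨y, rfl⟩ := Ideal.Quotient.mk_surjective x
  -- `y² - y ∈ (1 - f)`, so `f (y² - y) = 0`
  have hy : y * y - y ∈ Ideal.span ({1 - f} : Set A) := by
    rw [← Ideal.Quotient.eq, map_mul]; exact hx.eq
  obtain ⟨c, hc⟩ := Ideal.mem_span_singleton'.1 hy
  have hfy : f * (y * y) = f * y := by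
    rw [← sub_eq_zero, ← mul_sub, ← hc, mul_comm c, ← mul_assoc, mul_sub, mul_one, hf.isIdempotentElem.eq, sub_self,
      zero_mul]
  have hg : IsIdempotentElem (f * y) := by
    change f * y * (f * y) = f * y
    rw [mul_mul_mul_comm, hf.isIdempotentElem.eq, hfy]
  have hmk : Ideal.Quotient.mk (Ideal.span {1 - f}) (f * y) = Ideal.Quotient.mk (Ideal.span {1 - f}) y := by
    rw [map_mul, mk_span_one_sub_self', one_mul]
  rcases hf.eq_zero_or_eq (f * y) hg (by rw [mul_right_comm, hf.isIdempotentElem.eq])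
    (by rw [← mul_assoc, hf.isIdempotentElem.eq]) with h0 | h1
  · left; rw [← hmk, h0, map_zero]
  · right; rw [← hmk, h1, mk_span_one_sub_self']

/-! ### §4 Reduced noetherian + no idempotents + locally a domain ⇒ domain -/

/-- **A reduced noetherian commutative ring without non-trivial idempotents whose localisations at maximal ideals are
domains is a domain.**  Two minimal primes under a common maximal ideal `P` both equal `ker (B → B_P)` (a prime, by
minimality), so distinct minimal primes are comaximal; with two of them, `a + b = 1`, `a ∈ 𝔮₁`, `b ∈ ⨅ 𝔮_{i ≠ 1}` gives
`ab ∈ ⨅ 𝔮ᵢ = nil(B) = 0`, hence a non-trivial idempotent `a`; so there is exactly one minimal prime, and it is `0`.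
[cite: StacksProject, Tag 030C] [cite: StacksProject, Tag 00EC] -/
theorem isDomain_of_forall_isIdempotentElem_of_isDomain_localization {B : Type*} [CommRing B] [IsNoetherianRing B]
    [IsReduced B] [Nontrivial B] (hconn : ∀ x : B, IsIdempotentElem x → x = 0 ∨ x = 1)
    (hdom : ∀ P : Ideal B, [P.IsMaximal] → IsDomain (Localization.AtPrime P)) : IsDomain B := by
  classical
  -- a minimal prime under a maximal `P` is the kernel of `B → B_P`
  have hker : ∀ (P : Ideal B) [P.IsMaximal] (q : Ideal B), q ∈ minimalPrimes B → q ≤ P →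
      q = RingHom.ker (algebraMap B (Localization.AtPrime P)) := by
    intro P _ q hq hqP
    haveI := hdom P
    have hK : (RingHom.ker (algebraMap B (Localization.AtPrime P))).IsPrime := RingHom.ker_isPrime _
    have hKq : RingHom.ker (algebraMap B (Localization.AtPrime P)) ≤ q := by
      intro x hx
      rw [RingHom.mem_ker, IsLocalization.map_eq_zero_iff P.primeCompl] at hx
      obtain ⟨⟨s, hs⟩, hsx⟩ := hx
      have hmem : s * x ∈ q := by rw [hsx]; exact q.zero_mem
      exact (hq.1.1.mem_or_mem hmem).resolve_left fun h => hs (hqP h)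
    exact le_antisymm (hq.2 ⟨hK, bot_le⟩ hKq) hKq
  -- distinct minimal primes are comaximal
  have hcomax : ∀ q ∈ minimalPrimes B, ∀ q' ∈ minimalPrimes B, q ≠ q' → q ⊔ q' = ⊤ := by
    intro q hq q' hq' hne
    by_contra htop
    obtain ⟨P, hP, hle⟩ := Ideal.exists_le_maximal _ htop
    exact hne ((hker P q hq (le_sup_left.trans hle)).trans (hker P q' hq' (le_sup_right.trans hle)).symm)
  -- the minimal primes intersect in `nil(B) = 0`
  have hinf : sInf (minimalPrimes B) = ⊥ := by
    rw [minimalPrimes, Ideal.sInf_minimalPrimes]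
    exact nilradical_eq_zero B
  -- at most one minimal prime
  have hsub : (minimalPrimes B).Subsingleton := by
    intro q hq q' hq'
    by_contra hne
    have hfin := minimalPrimes.finite_of_isNoetherianRing B
    -- `J = ⨅ (minimal primes ≠ q)` is comaximal to `q`
    have hqJ : q ⊔ ⨅ p ∈ hfin.toFinset.erase q, p = ⊤ :=
      Ideal.sup_iInf_eq_top fun p hp => by
        rw [Finset.mem_erase, Set.Finite.mem_toFinset] at hp
        exact hcomax q hq p hp.2 (Ne.symm hp.1)
    obtain ⟨a, ha, b, hb, hab⟩ := Submodule.mem_sup.1 ((Ideal.eq_top_iff_one _).1 hqJ)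
    have hbq' : b ∈ q' := by
      have hq'mem : q' ∈ hfin.toFinset.erase q := by
        rw [Finset.mem_erase, Set.Finite.mem_toFinset]; exact ⟨Ne.symm hne, hq'⟩
      exact (iInf_le_of_le q' (iInf_le_of_le hq'mem le_rfl) : (⨅ p ∈ hfin.toFinset.erase q, p) ≤ q') hb
    -- `a b` lies in every minimal prime, hence is `0`
    have hab0 : a * b = 0 := by
      have hmem : a * b ∈ sInf (minimalPrimes B) := by
        rw [Submodule.mem_sInf]
        intro p hp
        by_cases hpq : p = q
        · subst hpq; exact Ideal.mul_mem_right _ p ha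
        · have hpmem : p ∈ hfin.toFinset.erase q := by
            rw [Finset.mem_erase, Set.Finite.mem_toFinset]; exact ⟨hpq, hp⟩
          exact Ideal.mul_mem_left p _ ((iInf_le_of_le p (iInf_le_of_le hpmem le_rfl) :
            (⨅ p ∈ hfin.toFinset.erase q, p) ≤ p) hb)
      rw [hinf] at hmem
      exact hmem
    -- so `a` is an idempotent, hence `0` or `1` — both absurd
    have haidem : IsIdempotentElem a := by
      change a * a = a
      calc a * a = a * (a + b) - a * b := by ring
        _ = a := by rw [hab, mul_one, hab0, sub_zero]
    rcases hconn a haidem with ha0 | ha1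
    · rw [ha0, zero_add] at hab
      rw [hab] at hbq'
      exact hq'.1.1.ne_top ((Ideal.eq_top_iff_one _).2 hbq')
    · rw [ha1] at ha
      exact hq.1.1.ne_top ((Ideal.eq_top_iff_one _).2 ha)
  -- exactly one minimal prime, equal to `⊥`; so `⊥` is prime
  obtain ⟨M, hM⟩ := Ideal.exists_maximal B
  obtain ⟨q₀, hq₀, -⟩ := Ideal.exists_minimalPrimes_le (I := (⊥ : Ideal B)) (J := M) bot_le
  have hq₀bot : q₀ = ⊥ := by
    rw [← hinf, hsub.eq_singleton_of_mem hq₀, sInf_singleton]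
  have hprime : (⊥ : Ideal B).IsPrime := hq₀bot ▸ hq₀.1.1
  haveI : NoZeroDivisors B := ⟨fun {x y} h =>
    ((hprime.mem_or_mem ((Ideal.mem_bot).2 h)).imp (Ideal.mem_bot).1 (Ideal.mem_bot).1)⟩
  exact NoZeroDivisors.to_isDomain B

end Commutative

/-! ### §5 Blocks of a reduced noetherian ring that is locally an (integrally closed) domain -/

section Blocks

variable {A : Type*} [CommRing A]

/-- `A ⧸ (1 - f)` is the localisation `A_f` of `A` at the idempotent `f` (Mathlib `IsLocalization.away_of_isIdempotentElem`).
[cite: StacksProject, Tag 00EC] -/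
theorem isLocalization_away_quotient_span_one_sub {f : A} (hf : IsIdempotentElem f) :
    IsLocalization.Away f (A ⧸ Ideal.span {1 - f}) :=
  IsLocalization.away_of_isIdempotentElem hf (by rw [Ideal.Quotient.algebraMap_eq, Ideal.mk_ker])
    Ideal.Quotient.mk_surjective

/-- The block at a non-zero idempotent is a non-trivial ring (a unit idempotent is `1`). [folklore] -/
private theorem nontrivial_quotient_span_one_sub {f : A} (hf : IsIdempotentElem f) (hf0 : f ≠ 0) :
    Nontrivial (A ⧸ Ideal.span {1 - f}) := by
  refine Ideal.Quotient.nontrivial_iff.mpr fun h => hf0 ?_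
  rw [Ideal.span_singleton_eq_top] at h
  have h1 : (1 - f) * (1 - f) = (1 - f) * 1 := by rw [mul_one]; exact hf.one_sub.eq
  have h2 : 1 - f = 1 := h.mul_left_cancel h1
  rwa [sub_eq_self] at h2

/-- **The local rings of the block `A ⧸ (1 - f)` are local rings of `A`**: for a prime `P` of the block,
`A_{P ∩ A} ≃ₐ[A] (A ⧸ (1 - f))_P` (the block is the localisation `A_f`, and a localisation of a localisation is a
localisation). [cite: StacksProject, Tag 00EC] -/
theorem nonempty_algEquiv_localization_quotient_span_one_sub {f : A} (hf : IsIdempotentElem f)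
    (P : Ideal (A ⧸ Ideal.span {1 - f})) [P.IsPrime] :
    Nonempty (Localization.AtPrime (P.comap (algebraMap A (A ⧸ Ideal.span {1 - f}))) ≃ₐ[A]
      Localization.AtPrime P) := by
  haveI := isLocalization_away_quotient_span_one_sub hf
  haveI : IsLocalization.AtPrime (Localization.AtPrime P) (P.comap (algebraMap A (A ⧸ Ideal.span {1 - f}))) :=
    IsLocalization.isLocalization_isLocalization_atPrime_isLocalization (Submonoid.powers f)
      (Localization.AtPrime P) P
  exact ⟨IsLocalization.algEquiv (P.comap (algebraMap A (A ⧸ Ideal.span {1 - f}))).primeCompl _ _⟩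

/-- **The block `A ⧸ (1 - f)` at a primitive idempotent `f` of a REDUCED NOETHERIAN ring whose localisations at maximal
ideals are DOMAINS is a domain** (it is reduced as a localisation of `A`, has the local rings of `A`, and no non-trivial
idempotents, §3–§4): the blocks are the irreducible = connected components of `Spec A`.
[cite: StacksProject, Tag 030C] [cite: StacksProject, Tag 00EC] -/
theorem isDomain_quotient_span_one_sub_of_isPrimitiveIdempotent [IsNoetherianRing A] [IsReduced A]
    (hdom : ∀ m : Ideal A, [m.IsMaximal] → IsDomain (Localization.AtPrime m)) {f : A}
    (hf : IsPrimitiveIdempotent f) : IsDomain (A ⧸ Ideal.span {1 - f}) := by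
  haveI := isLocalization_away_quotient_span_one_sub hf.isIdempotentElem
  haveI : IsReduced (A ⧸ Ideal.span {1 - f}) :=
    isReduced_localizationPreserves (Submonoid.powers f) (A ⧸ Ideal.span {1 - f}) inferInstance
  haveI := nontrivial_quotient_span_one_sub hf.isIdempotentElem hf.ne_zero
  refine isDomain_of_forall_isIdempotentElem_of_isDomain_localization
    (eq_zero_or_eq_one_of_isIdempotentElem_quotient hf) fun P _ => ?_
  haveI : (P.comap (algebraMap A (A ⧸ Ideal.span {1 - f}))).IsMaximal :=
    Ideal.comap_isMaximal_of_surjective _ Ideal.Quotient.mk_surjective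
  haveI := hdom (P.comap (algebraMap A (A ⧸ Ideal.span {1 - f})))
  obtain ⟨e⟩ := nonempty_algEquiv_localization_quotient_span_one_sub hf.isIdempotentElem P
  exact MulEquiv.isDomain (Localization.AtPrime (P.comap (algebraMap A (A ⧸ Ideal.span {1 - f}))))
    e.symm.toMulEquiv

/-- **… and it is INTEGRALLY CLOSED when the localisations of `A` at maximal ideals are integrally closed domains**
(Mathlib `IsIntegrallyClosed.of_localization_maximal` on the domain `A ⧸ (1 - f)`, whose local rings are those of `A`):
a normal noetherian ring is the product of its blocks, each an integrally closed domain.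
[cite: StacksProject, Tag 030C] -/
theorem isIntegrallyClosed_quotient_span_one_sub_of_isPrimitiveIdempotent [IsNoetherianRing A] [IsReduced A]
    (hdom : ∀ m : Ideal A, [m.IsMaximal] → IsDomain (Localization.AtPrime m))
    (hic : ∀ m : Ideal A, [m.IsMaximal] → IsIntegrallyClosed (Localization.AtPrime m)) {f : A}
    (hf : IsPrimitiveIdempotent f) : IsIntegrallyClosed (A ⧸ Ideal.span {1 - f}) := by
  haveI := isDomain_quotient_span_one_sub_of_isPrimitiveIdempotent hdom hf
  refine IsIntegrallyClosed.of_localization_maximal fun P _ hP => ?_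
  haveI : (P.comap (algebraMap A (A ⧸ Ideal.span {1 - f}))).IsMaximal :=
    Ideal.comap_isMaximal_of_surjective _ Ideal.Quotient.mk_surjective
  haveI := hic (P.comap (algebraMap A (A ⧸ Ideal.span {1 - f})))
  obtain ⟨e⟩ := nonempty_algEquiv_localization_quotient_span_one_sub hf.isIdempotentElem P
  exact IsIntegrallyClosed.of_equiv e.toRingEquiv

/-- **Summary for the consumer (fibre charts): in a reduced noetherian ring that is locally an integrally closed domain,
the primitive idempotents are finitely many, form a complete orthogonal family, and every block `A ⧸ (1 - f)` is an
integrally closed domain.** [cite: StacksProject, Tag 030C] [cite: Lam2001FirstCourse, §22 Thm. (22.5)] -/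
theorem blocks_isDomain_and_isIntegrallyClosed [IsNoetherianRing A] [IsReduced A]
    (hdom : ∀ m : Ideal A, [m.IsMaximal] → IsDomain (Localization.AtPrime m))
    (hic : ∀ m : Ideal A, [m.IsMaximal] → IsIntegrallyClosed (Localization.AtPrime m)) :
    (Set.Finite {f : A | IsPrimitiveIdempotent f}) ∧
      (∀ [Fintype {f : A // IsPrimitiveIdempotent f}],
        CompleteOrthogonalIdempotents (Subtype.val : {f : A // IsPrimitiveIdempotent f} → A)) ∧
      ∀ f : A, IsPrimitiveIdempotent f →
        IsDomain (A ⧸ Ideal.span {1 - f}) ∧ IsIntegrallyClosed (A ⧸ Ideal.span {1 - f}) :=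
  ⟨finite_setOf_isPrimitiveIdempotent, fun {_} => completeOrthogonalIdempotents_subtype_isPrimitiveIdempotent,
    fun _ hf => ⟨isDomain_quotient_span_one_sub_of_isPrimitiveIdempotent hdom hf,
      isIntegrallyClosed_quotient_span_one_sub_of_isPrimitiveIdempotent hdom hic hf⟩⟩

end Blocks

end Literature.RingTheory.Idempotents
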